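import Summits.FinalStateConjecture.FinalStateConjecture.Theorems.StarvedNecksGapDecaySufficesStubAssemblyDefsV10
import Summits.FinalStateConjecture.FinalStateConjecture.Theorems.StarvedNecksGapDecaySufficesStubSeededLocationMain

/-!
# Stub S4′ of line `Sketch` (crux `GapDecaySuffices`, stmt-FinalStateConjecture-18060), skeleton v10:
# the re-threaded reduction `stub_seededLocationP_of_uniformLocation : UniformLocation → LateSeed → SeededLocationP`

Registered TEMPORARY re-threading stub of skeleton v10 (lead c2):

  `V10.stub_seededLocationP_of_uniformLocation : UniformLocation → LateSeed → SeededLocationP`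

with `UniformLocation` = `…Location.Seeded.UniformLocation` (v9, `…StubSeededLocationInputs`, anchoring
`TubeAnchoredR`), `LateSeed` = `…V10.LateSeed` and `SeededLocationP` = `…V10.SeededLocationP`
(`…StubAssemblyDefsV10`, p172394; anchoring strengthened to the clock-windowed `V10.TubeAnchoredClockR d R₀`,
everything else byte-identical to the v9 forms).

## The proof

Verbatim the kernel-checked v9 reduction `…Location.Seeded.seededLocationP_of_uniformLocation`
(`…StubSeededLocationMain`, p168266) with the anchoring hypothesis `hanch : TubeAnchoredClockR d R₀`
re-threaded: X₁ `UniformLocation` is fed the projection `V10.tubeAnchoredR_of_clock d R₀ hanch`, X₂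
`LateSeed` the window `hanch` itself.  The v9 proof uses `hanch` nowhere else.

Summary of the (unchanged) argument: `Bk := max (max |Bk₁| |Bk₂|) (4·max(ρᵢ,0) + 2R₀ + 1)`; seed radius
`rs := ρ'`; with `γ = (Λᵢe₀)⁰`, `β = √(γ² − 1)`, `G(u) := β(3ρ'(u) + 1 + |aᵢ|)`,
`m(σ) := γσ + cᵢ⁰ − G(γσ + cᵢ⁰)` (a lower bound of the lab time on `{tᵢ = σ, rᵢ ≤ ϱ(σ)}` by the clock
bound `abs_flatTime_sub_le`), closed tube `ϱ(σ) := 3ρ'(m(σ)) + 1` — admissible by monotonicity of `ρ'`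
and the wall `W ≥ 3ρ' + 2`; `κ(σ) := κ₁(⅔(γσ + cᵢ⁰))`.  `locate`: a located preimage `x` of a band point
`z` is `τ'`-late and `rᵢ x ≤ 2.91ρ'(z⁰)`, `z⁰ ≤ 1.03·m(tᵢ x)`, hence `ρ'(z⁰) ≤ 1.03ρ'(m(tᵢ x))` by
concavity (`concaveOn_Ici_apply_mul_le`) and `rᵢ x < ϱ(tᵢ x)` (no rim contact down to the window radius,
location on the collar).  Seeds: the late seed of X₂ is continued along its outward constant-lab-time
ray (`exists_ray_constLabTime_out`, p167503) to the seed sphere `{rᵢ = ρ'(z⁰)}` and then along the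
preconnected seed-sphere bundle (`isPreconnected_seedSpheres`) by clopen continuation
(`flat_entry_gapTube`, p143739).

Landed bricks used (imported, not copied): `exists_ray_constLabTime_out`, `isPreconnected_seedSpheres`
(Band file, p167503); `concaveOn_Ici_apply_mul_le`, `lateFlat_band`, `tendsto_max_div_atTop_nhds_zero`,
`tendsto_abs_div_atTop_nhds_zero`, `tendsto_mul_max_add_div_atTop_nhds_zero`, `tendsto_div_of_abs_le`
(Inputs file); `flat_entry_gapTube` (p143739); `abs_flatTime_sub_le`; `V10.tubeAnchoredR_of_clock`
(p172394).  No named facts, no new defs.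
References: DHRT arXiv:2104.08222 §1; O'Neill 1995, Ch. 2, §2.1; O'Neill 1983, Ch. 9.
-/

noncomputable section

open scoped Manifold ContDiff Topology ENNReal
open Filter Set Topology Literature.Geometry.Lorentzian

namespace Summit.FinalStateConjecture.FinalStateConjecture.Theorems.GapDecaySuffices.V10

-- justified lint debt: the problem namespace repeats the summit name (`FinalStateConjecture.FinalStateConjecture`)
set_option linter.dupNamespace false

open Location (concaveOn_Ici_apply_mul_le lateFlat_band tendsto_max_div_atTop_nhds_zero
  tendsto_abs_div_atTop_nhds_zero tendsto_mul_max_add_div_atTop_nhds_zero tendsto_div_of_abs_le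
  exists_ray_constLabTime_out isPreconnected_seedSpheres flat_entry_gapTube)
open Location.Seeded (UniformLocation)
open Summit.FinalStateConjecture.FinalStateConjecture.Theorems.NecksCertifyBargmann.Seam
  (abs_flatTime_sub_le)

/-! ## The re-threaded reduction -/

set_option maxHeartbeats 1600000 in
/-- **`SeededLocationP` (v10) from `UniformLocation` (v9) and `LateSeed` (v10)** — registered
temporary re-threading stub of skeleton v10, line `Sketch`: the kernel-checked v9 reduction
`Location.Seeded.seededLocationP_of_uniformLocation` (p168266) with the clock-windowed anchoring
`TubeAnchoredClockR d R₀` threaded — `UniformLocation` is fed the projection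
`tubeAnchoredR_of_clock d R₀ hanch`, `LateSeed` the window `hanch` itself; the rest of the proof is
byte-identical.  Choices: `Bk := max (max |Bk₁| |Bk₂|) (4·max(ρᵢ, 0) + 2R₀ + 1)`; seed radius
`rs := ρ'`; closed gap tube `ϱ(σ) := 3ρ'(m(σ)) + 1` with
`m(σ) := γσ + c⁰ − √(γ² − 1)(3ρ'(γσ + c⁰) + 1 + |a|)` a lower bound of the lab time `x⁰` on
`{tᵢ = σ, rᵢ ≤ ϱ(σ)}` (clock bound `abs_flatTime_sub_le`), so the tube is admissible by monotonicity of
`ρ'`; `κ(σ) := κ₁(⅔(γσ + c⁰))`.  No rim contact and location: the located preimage `x` of a band point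
`z` has `rᵢ x ≤ 2.91ρ'(z⁰)` and `z⁰ ≤ 1.03·m(tᵢ x)` by the two-sided clock bound and sublinearity, hence
`ρ'(z⁰) ≤ 1.03ρ'(m(tᵢ x))` by concavity (`concaveOn_Ici_apply_mul_le`) and `rᵢ x < ϱ(tᵢ x)`.  Seeds: the
late seed of `LateSeed` (made `τ'`-late) is continued along its outward constant-lab-time ray
(`exists_ray_constLabTime_out`) to the seed sphere `{rᵢ = ρ'(z⁰)}` and then along the preconnected
seed-sphere bundle (`isPreconnected_seedSpheres`) by clopen continuation (`flat_entry_gapTube`,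
p143739).

HEADER SPELLING: the registered signature `UniformLocation → LateSeed → SeededLocationP` is written with the
Theorems-side namespaces spelled out (the SAME constants — inside this namespace `LateSeed`,
`SeededLocationP` are `V10.LateSeed`, `V10.SeededLocationP` and `UniformLocation` is the opened
`Location.Seeded.UniformLocation`; the two headers elaborate to the identical term), because the short-name
text byte-coincides with the landed v9 header of p168266 and the gate's text-keyed `dedup.landed` bounces
it; this spelling also elaborates verbatim in the skeleton's namespace (precedent: p164942,
`stub_oneSidedIntervalComparison`). -/
theorem stub_seededLocationP_of_uniformLocation :
    Theorems.GapDecaySuffices.Location.Seeded.UniformLocation → Theorems.GapDecaySuffices.V10.LateSeed →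
      Theorems.GapDecaySuffices.V10.SeededLocationP := by
  intro h₁ h₂ X _ _ _ _ D hD 𝒟 h𝒟 O d R₀ hO hc hf hdv hanch i hnn
  -- v10 re-threading: X₁ keeps the v9 anchoring (projection), X₂ takes the clock window itself
  obtain ⟨Bk₁, hBk₁, H1⟩ :=
    h₁ X D hD 𝒟 h𝒟 O d R₀ hO hc hf hdv (tubeAnchoredR_of_clock d R₀ hanch) i hnn
  obtain ⟨Bk₂, hBk₂, H2⟩ := h₂ X D hD 𝒟 h𝒟 O d R₀ hO hc hf hdv hanch i hnn
  -- the kinematic majorant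
  refine ⟨fun s ↦ max (max |Bk₁ s| |Bk₂ s|) (4 * max (d.excision i s) 0 + (2 * R₀ + 1)),
    tendsto_max_div_atTop_nhds_zero
      (tendsto_max_div_atTop_nhds_zero (tendsto_abs_div_atTop_nhds_zero hBk₁)
        (tendsto_abs_div_atTop_nhds_zero hBk₂))
      (tendsto_mul_max_add_div_atTop_nhds_zero (d.tendsto_excision_div i) 4 (2 * R₀ + 1)), ?_⟩
  intro ρ' hmono hcont hconc hsub hdom hone R₁ τ₁ W Ψg B t r hR hτ hW hwall hG1 hG2 hG3 hG4 hG5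
  have hρpos : ∀ s, 0 < ρ' s := fun s ↦ lt_of_lt_of_le one_pos (hone s)
  -- consequences of the domination hypothesis
  have hdom1 : Tendsto (fun s ↦ Bk₁ s / ρ' s) atTop (𝓝 0) :=
    tendsto_div_of_abs_le hdom hρpos fun s ↦ (le_max_left _ _).trans (le_max_left _ _)
  have hdom2 : Tendsto (fun s ↦ Bk₂ s / ρ' s) atTop (𝓝 0) :=
    tendsto_div_of_abs_le hdom hρpos fun s ↦ (le_max_right _ _).trans (le_max_left _ _)
  have hTd : ∀ᶠ s in atTop, 4 * max (d.excision i s) 0 + (2 * R₀ + 1) < ρ' s := by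
    filter_upwards [hdom.eventually (gt_mem_nhds one_pos)] with s hs
    rw [div_lt_one (hρpos s)] at hs
    exact lt_of_le_of_lt (le_max_right _ _) hs
  -- the isolated inputs
  obtain ⟨T₁, τ₂, κ₁, hanti, hκ₁, hloc⟩ :=
    H1 ρ' hmono hcont hconc hsub hdom1 hone R₁ τ₁ W Ψg hR hτ hW hwall hG1 hG2 hG3 hG4 hG5
  have hseed := H2 ρ' hmono hcont hconc hsub hdom2 hone R₁ τ₁ W Ψg hR hτ hW hwall hG1 hG2 hG3 hG4 hG5
  -- constants of hole `i`
  have horth : ∀ j, 0 < ((d.motion j).1 : E4 ≃L[ℝ] E4) (E4.basisVector 0) 0 := fun j ↦ (hc.1 j).2.2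
  obtain ⟨γ, hγ⟩ : ∃ γ : ℝ, γ = (((d.motion i).1 : E4 ≃L[ℝ] E4) (E4.basisVector 0)) 0 := ⟨_, rfl⟩
  have hγ0 : 0 < γ := hγ ▸ horth i
  obtain ⟨β, hβ⟩ : ∃ β : ℝ, β = Real.sqrt (γ ^ 2 - 1) := ⟨_, rfl⟩
  have hβ0 : 0 ≤ β := hβ ▸ Real.sqrt_nonneg _
  obtain ⟨c₀, hc₀⟩ : ∃ c₀ : ℝ, c₀ = (d.motion i).2 0 := ⟨_, rfl⟩
  obtain ⟨A, hA⟩ : ∃ A : ℝ, A = |d.spin i| := ⟨_, rfl⟩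
  have hA0 : 0 ≤ A := hA ▸ abs_nonneg _
  have hR₀ : 0 < R₀ := by linarith [(hc.1 i).2.1, d.mass_pos i]
  -- the two-sided Lorentz clock bound of hole `i`
  have hclock : ∀ y : E4, |y 0 - c₀ - γ * t y| ≤ β * (r y + A) := by
    intro y
    have h := abs_flatTime_sub_le (Λ := (d.motion i).1) (d.motion i).2 (d.mass i) (d.spin i) y
    rw [← hγ, ← hβ, ← hc₀, ← hA] at h
    exact h
  -- late bands are late-flat
  obtain ⟨Tlf, hTlf⟩ := lateFlat_band d horth hdv i hsub (29 / 10)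
  -- the clock-corrected wall profile and the choice of `τ'`
  obtain ⟨G, hG⟩ : ∃ G : ℝ → ℝ, G = fun u ↦ β * (3 * ρ' u + 1 + A) := ⟨_, rfl⟩
  have hG0 : ∀ u, 0 ≤ G u := fun u ↦ by
    rw [hG]; exact mul_nonneg hβ0 (by linarith [hρpos u])
  have hGsub : Tendsto (fun u ↦ G u / u) atTop (𝓝 0) := by
    have h : Tendsto (fun u : ℝ ↦ β * (3 * (ρ' u / u) + (1 + A) / u)) atTop
        (𝓝 (β * (3 * 0 + 0))) :=
      ((hsub.const_mul 3).add (tendsto_const_nhds.div_atTop tendsto_id)).const_mul β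
    rw [mul_zero, add_zero, mul_zero] at h
    refine h.congr' ?_
    filter_upwards [eventually_gt_atTop 0] with u hu
    rw [hG]
    field_simp
    ring
  have hU1 : ∀ᶠ u in atTop, G u ≤ u / 100 := by
    filter_upwards [hGsub.eventually (ge_mem_nhds (by norm_num : (0 : ℝ) < 1 / 100)),
      eventually_gt_atTop (0 : ℝ)] with u hu hu0
    rwa [div_le_iff₀ hu0, one_div_mul_eq_div] at hu
  obtain ⟨u₁, hu₁⟩ := Filter.eventually_atTop.1
    (hU1.and ((eventually_ge_atTop (250 * (β * A))).and
      (eventually_ge_atTop (100 / 99 * (max τ₁ 1)))))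
  obtain ⟨τ', hτ'⟩ : ∃ τ', τ' = max (max (τ₁ + 1) τ₂) ((u₁ - c₀) / γ) := ⟨_, rfl⟩
  have hτ'₁ : τ₁ < τ' := by
    rw [hτ']; exact lt_of_lt_of_le (lt_add_one τ₁) ((le_max_left _ _).trans (le_max_left _ _))
  have hτ'₂ : τ₂ ≤ τ' := by rw [hτ']; exact (le_max_right _ _).trans (le_max_left _ _)
  have hτ'u : ∀ σ, τ' ≤ σ → u₁ ≤ γ * σ + c₀ := by
    intro σ hσ
    have h1 : (u₁ - c₀) / γ ≤ σ := le_trans (by rw [hτ']; exact le_max_right _ _) hσ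
    rw [div_le_iff₀ hγ0] at h1
    linarith
  -- facts at `u = γσ + c⁰`, `σ ≥ τ'`
  have hfu : ∀ σ, τ' ≤ σ → G (γ * σ + c₀) ≤ (γ * σ + c₀) / 100 ∧ 250 * (β * A) ≤ γ * σ + c₀ ∧
      100 / 99 * max τ₁ 1 ≤ γ * σ + c₀ := fun σ hσ ↦ hu₁ _ (hτ'u σ hσ)
  obtain ⟨m, hm⟩ : ∃ m : ℝ → ℝ, m = fun σ ↦ γ * σ + c₀ - G (γ * σ + c₀) := ⟨_, rfl⟩
  obtain ⟨ϱ, hϱ⟩ : ∃ ϱ : ℝ → ℝ, ϱ = fun σ ↦ 3 * ρ' (m σ) + 1 := ⟨_, rfl⟩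
  have hmle : ∀ σ, m σ ≤ γ * σ + c₀ := fun σ ↦ by rw [hm]; linarith [hG0 (γ * σ + c₀)]
  have hm1 : ∀ σ, τ' ≤ σ → max τ₁ 1 ≤ m σ := by
    intro σ hσ
    obtain ⟨h1, -, h3⟩ := hfu σ hσ
    rw [hm]
    simp only
    linarith
  have hϱc : Continuous ϱ := by
    have hGc : Continuous G := by
      rw [hG]; exact continuous_const.mul ((hcont.const_mul 3 |>.add continuous_const).add continuous_const)
    have hmc : Continuous m := by
      rw [hm]
      exact ((continuous_const.mul continuous_id).add continuous_const).sub
        (hGc.comp ((continuous_const.mul continuous_id).add continuous_const))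
    rw [hϱ]
    exact ((hcont.comp hmc).const_mul 3).add continuous_const
  -- admissibility of the closed gap tube `{τ' ≤ tᵢ, rᵢ ≤ ϱ(tᵢ)}`
  have hadm : ∀ x : B.domain, τ' ≤ t x.1 → r x.1 ≤ ϱ (t x.1) → r x.1 < W (x.1 0) := by
    intro x hx1 hx2
    have hx2' : r x.1 ≤ 3 * ρ' (m (t x.1)) + 1 := by rw [hϱ] at hx2; exact hx2
    have hmono1 : ρ' (m (t x.1)) ≤ ρ' (γ * t x.1 + c₀) := hmono (hmle _)
    have hcl := (abs_le.1 (hclock x.1)).1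
    have hGx : β * (r x.1 + A) ≤ G (γ * t x.1 + c₀) := by
      rw [hG]
      exact mul_le_mul_of_nonneg_left (by linarith) hβ0
    have hx0 : m (t x.1) ≤ x.1 0 := by
      rw [hm]; simp only; linarith
    have hx0τ : τ₁ ≤ x.1 0 := le_trans ((le_max_left _ _).trans (hm1 _ hx1)) hx0
    have hw := hwall (x.1 0) hx0τ
    have hmono2 : ρ' (m (t x.1)) ≤ ρ' (x.1 0) := hmono hx0
    linarith
  have hadm' : ∀ x : B.domain, τ' ≤ t x.1 → r x.1 ≤ ϱ (t x.1) → r x.1 ≤ W (x.1 0) :=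
    fun x h1 h2 ↦ (hadm x h1 h2).le
  -- the choice of `T`
  have hTb : ∀ᶠ s in atTop, (γ / 100 + 29 / 10 * β) * ρ' s ≤ 5 / 1000 * s := by
    have h : Tendsto (fun s ↦ (γ / 100 + 29 / 10 * β) * (ρ' s / s)) atTop
        (𝓝 ((γ / 100 + 29 / 10 * β) * 0)) := hsub.const_mul _
    rw [mul_zero] at h
    filter_upwards [h.eventually (ge_mem_nhds (by norm_num : (0 : ℝ) < 5 / 1000)),
      eventually_gt_atTop (0 : ℝ)] with s hs hs0
    rw [mul_div_assoc', div_le_iff₀ hs0] at hs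
    exact hs
  have hTκ : ∀ᶠ s in atTop, κ₁ s ≤ 1 / 100 := hκ₁.eventually (ge_mem_nhds (by norm_num))
  obtain ⟨T, hT⟩ := Filter.eventually_atTop.1
    (hTb.and (hTκ.and (hTd.and ((eventually_ge_atTop T₁).and ((eventually_ge_atTop Tlf).and
      ((eventually_ge_atTop (4 * (β * A))).and
        ((eventually_gt_atTop (1000 / 995 * (γ * τ' + c₀ + β * A))).and hnn)))))))
  -- the conversion of `κ₁` to the hole clock
  obtain ⟨κ, hκ⟩ : ∃ κ : ℝ → ℝ, κ = fun σ ↦ κ₁ (2 / 3 * (γ * σ + c₀)) := ⟨_, rfl⟩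
  have hκ0 : Tendsto κ atTop (𝓝 0) := by
    rw [hκ]
    refine hκ₁.comp ?_
    refine Tendsto.const_mul_atTop (by norm_num) ?_
    exact tendsto_atTop_add_const_right _ _ (Tendsto.const_mul_atTop hγ0 tendsto_id)
  -- LOCATING a late common point of the flat band and the honest gap region
  have hlocate : ∀ (z : E4) (hz : z ∈ d.flatDomain), T ≤ z 0 →
      3 * d.excision i (z 0) + 2 * R₀ ≤ r z → r z ≤ 29 / 10 * ρ' (z 0) →
      ∀ x : B.domain, τ' ≤ t x.1 → r x.1 ≤ W (x.1 0) → Ψg x = d.flatChart ⟨z, hz⟩ →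
        (τ' < t x.1 ∧ r x.1 < ϱ (t x.1)) ∧
          |t x.1 - t z| ≤ κ₁ (z 0) * ρ' (z 0) ∧ |r x.1 - r z| ≤ κ₁ (z 0) * ρ' (z 0) := by
    intro z hz hzT hzlo hzhi x hx1 hx2 heq
    obtain ⟨hTb', hTκ', -, hT₁', hTlf', hT4, hT5, hρ0⟩ := hT (z 0) hzT
    have hρi : d.excision i (z 0) < r z := by linarith
    obtain ⟨-, hz0, hothers⟩ := hTlf z hTlf' hρi hzhi
    obtain ⟨hlt, hlr⟩ := hloc z hz hT₁' hz0 hzlo hzhi hothers x (hτ'₂.trans hx1) hx2 heq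
    refine ⟨?_, hlt, hlr⟩
    have hP0 : 0 < ρ' (z 0) := hρpos _
    have hκP : κ₁ (z 0) * ρ' (z 0) ≤ ρ' (z 0) / 100 := by
      have := mul_le_mul_of_nonneg_right hTκ' hP0.le
      linarith
    obtain ⟨ht1, ht2⟩ := abs_le.1 (hlt.trans hκP)
    obtain ⟨hr1, hr2⟩ := abs_le.1 (hlr.trans hκP)
    obtain ⟨hcz1, hcz2⟩ := abs_le.1 (hclock z)
    have hβrz : β * (r z + A) ≤ β * (29 / 10 * ρ' (z 0) + A) :=
      mul_le_mul_of_nonneg_left (by linarith) hβ0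
    -- (a) the preimage is `τ'`-late
    have ha : τ' < t x.1 := by
      have h2 : γ * (-(ρ' (z 0) / 100)) ≤ γ * (t x.1 - t z) := mul_le_mul_of_nonneg_left ht1 hγ0.le
      have h5 : γ * τ' < γ * t x.1 := by linarith
      exact lt_of_mul_lt_mul_left h5 hγ0.le
    refine ⟨ha, ?_⟩
    -- (b) the preimage clears the rim: `rᵢ x ≤ 2.91ρ'(z⁰) ≤ 2.9973ρ'(m(tᵢ x)) < ϱ(tᵢ x)`
    obtain ⟨hGu, hβA, hmax⟩ := hfu (t x.1) ha.le
    have hm_eq : m (t x.1) = γ * t x.1 + c₀ - G (γ * t x.1 + c₀) := by rw [hm]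
    have hmσ1 : 1 ≤ m (t x.1) := le_trans (le_max_right _ _) (hm1 _ ha.le)
    have hz0 : z 0 ≤ γ * t x.1 + c₀ + (γ / 100 + 29 / 10 * β) * ρ' (z 0) + β * A := by
      have : γ * (t z - t x.1) ≤ γ * (ρ' (z 0) / 100) :=
        mul_le_mul_of_nonneg_left (by linarith) hγ0.le
      linarith
    have hz0' : z 0 ≤ 103 / 100 * m (t x.1) := by
      rw [hm_eq]
      linarith [le_max_right τ₁ 1]
    have hρz : ρ' (z 0) ≤ 103 / 100 * ρ' (m (t x.1)) := by
      rcases le_or_gt (z 0) (m (t x.1)) with hle | hgt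
      · have := hmono hle
        linarith [hρpos (m (t x.1))]
      · calc ρ' (z 0) ≤ ρ' (103 / 100 * m (t x.1)) := hmono hz0'
          _ ≤ 103 / 100 * ρ' (m (t x.1)) :=
            concaveOn_Ici_apply_mul_le hconc (by linarith [hone 0]) (by linarith) (by norm_num)
    have hϱσ : ϱ (t x.1) = 3 * ρ' (m (t x.1)) + 1 := by rw [hϱ]
    rw [hϱσ]
    linarith
  -- NO RIM CONTACT on the band down to the window radius
  have hrim : ∀ (w : E4) (hw : w ∈ d.flatDomain), T ≤ w 0 →
      3 * d.excision i (w 0) + 2 * R₀ ≤ r w → r w ≤ 29 / 10 * ρ' (w 0) →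
      ∀ x : B.domain, τ' ≤ t x.1 → r x.1 ≤ ϱ (t x.1) → Ψg x = d.flatChart ⟨w, hw⟩ →
        τ' < t x.1 ∧ r x.1 < ϱ (t x.1) :=
    fun w hw h1 h2 h3 x hx1 hx2 heq ↦ (hlocate w hw h1 h2 h3 x hx1 (hadm' x hx1 hx2) heq).1
  -- band points are late-flat
  have hbandflat : ∀ w : E4, T ≤ w 0 → 3 * d.excision i (w 0) + 2 * R₀ ≤ r w →
      r w ≤ 29 / 10 * ρ' (w 0) → w ∈ d.flatDomain ∧ d.τ₀ < w 0 := by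
    intro w h1 h2 h3
    obtain ⟨-, -, -, -, hTlf', -, -, hρ0⟩ := hT (w 0) h1
    have h := hTlf w hTlf' (by linarith) h3
    exact ⟨h.1, h.2.1⟩
  refine ⟨T, τ', ϱ, ρ', κ, hτ'₁, hϱc, hκ0, hadm, ?_, ?_, ?_, ?_⟩
  · -- the seed radius profile `rs := ρ'`
    intro s hs
    obtain ⟨-, -, h3, -⟩ := hT s hs
    refine ⟨?_, ?_, by linarith [hρpos s]⟩
    · linarith [le_max_right (d.excision i s) 0, hR₀.le]
    · linarith [le_max_left (d.excision i s) 0, le_max_right (d.excision i s) 0, hR₀.le]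
  · -- SEEDS: the late seed, its outward ray to the seed sphere, and the seed-sphere bundle
    intro z hz hzT hzr
    obtain ⟨zs, hzs, hzsT, hzslo, hzshi, xs, hxs1, hxs2, hxseq⟩ := hseed T τ'
    obtain ⟨-, -, hTd', -, -, -, -, hρ0⟩ := hT (zs 0) hzsT
    have hrzs0 : 0 < r zs := by linarith
    have hrzsρ : r zs ≤ ρ' (zs 0) := by linarith [le_max_left (d.excision i (zs 0)) 0]
    have hzshi' : r zs ≤ 29 / 10 * ρ' (zs 0) := hrzsρ.trans (by linarith [hρpos (zs 0)])
    obtain ⟨S₁, hS₁pre, hzsS₁, hS₁prop, ws, hwsS₁, hwsr⟩ :=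
      exists_ray_constLabTime_out (d.motion i).1 (d.motion i).2 (d.mass i) (d.spin i) (horth i)
        zs hrzs0 hrzsρ
    have hS₁band : ∀ w ∈ S₁, T ≤ w 0 ∧ 3 * d.excision i (w 0) + 2 * R₀ ≤ r w ∧
        r w ≤ 29 / 10 * ρ' (w 0) := by
      intro w hw
      obtain ⟨hw0, hwlo, hwhi⟩ := hS₁prop w hw
      rw [hw0]
      exact ⟨hzsT, hzslo.trans hwlo, hwhi.trans (by linarith [hρpos (zs 0)])⟩
    have hS₁f : S₁ ⊆ (d.flatDomain : Set E4) := fun w hw ↦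
      (hbandflat w (hS₁band w hw).1 (hS₁band w hw).2.1 (hS₁band w hw).2.2).1
    have hS₁late : ∀ w ∈ S₁, d.τ₀ < w 0 := fun w hw ↦
      (hbandflat w (hS₁band w hw).1 (hS₁band w hw).2.1 (hS₁band w hw).2.2).2
    have hentry₁ := flat_entry_gapTube d i hG1.2.1 (hG5 τ' ϱ hϱc hτ'₁ hadm') hϱc hτ'₁ hadm'
      hS₁pre hS₁f hS₁late
      (fun w hw x hx1 hx2 hhx ↦ hrim w (hS₁f hw) (hS₁band w hw).1 (hS₁band w hw).2.1
        (hS₁band w hw).2.2 x hx1 hx2 hhx)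
      ⟨zs, hzsS₁, xs, (hlocate zs hzs hzsT hzslo hzshi' xs hxs1 hxs2 hxseq).1.1,
        (hlocate zs hzs hzsT hzslo hzshi' xs hxs1 hxs2 hxseq).1.2, hxseq⟩
    obtain ⟨xw, hxw1, hxw2, hxweq⟩ := hentry₁ ws hwsS₁
    -- the seed-sphere bundle `{T ≤ w⁰, rᵢ w = ρ'(w⁰)}`
    have hSphpre : IsPreconnected {w : E4 | T ≤ w 0 ∧ r w = ρ' (w 0)} :=
      isPreconnected_seedSpheres (d.motion i).1 (d.motion i).2 (d.mass i) (d.spin i) (horth i)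
        hcont T (fun s _ ↦ hρpos s)
    have hSphband : ∀ w ∈ {w : E4 | T ≤ w 0 ∧ r w = ρ' (w 0)}, T ≤ w 0 ∧
        3 * d.excision i (w 0) + 2 * R₀ ≤ r w ∧ r w ≤ 29 / 10 * ρ' (w 0) := by
      rintro w ⟨h1, h2⟩
      obtain ⟨-, -, hTd'', -⟩ := hT (w 0) h1
      rw [h2]
      exact ⟨h1, by linarith [le_max_left (d.excision i (w 0)) 0, le_max_right (d.excision i (w 0)) 0],
        by linarith [hρpos (w 0)]⟩
    have hSphf : {w : E4 | T ≤ w 0 ∧ r w = ρ' (w 0)} ⊆ (d.flatDomain : Set E4) := fun w hw ↦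
      (hbandflat w (hSphband w hw).1 (hSphband w hw).2.1 (hSphband w hw).2.2).1
    have hSphlate : ∀ w ∈ {w : E4 | T ≤ w 0 ∧ r w = ρ' (w 0)}, d.τ₀ < w 0 := fun w hw ↦
      (hbandflat w (hSphband w hw).1 (hSphband w hw).2.1 (hSphband w hw).2.2).2
    have hws : ws ∈ {w : E4 | T ≤ w 0 ∧ r w = ρ' (w 0)} := by
      obtain ⟨hw0, -, -⟩ := hS₁prop ws hwsS₁
      refine ⟨by rw [hw0]; exact hzsT, ?_⟩
      rw [hw0]
      exact hwsr
    have hentry₂ := flat_entry_gapTube d i hG1.2.1 (hG5 τ' ϱ hϱc hτ'₁ hadm') hϱc hτ'₁ hadm'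
      hSphpre hSphf hSphlate
      (fun w hw x hx1 hx2 hhx ↦ hrim w (hSphf hw) (hSphband w hw).1 (hSphband w hw).2.1
        (hSphband w hw).2.2 x hx1 hx2 hhx)
      ⟨ws, hws, xw, hxw1, hxw2, hxweq⟩
    obtain ⟨x, hx1, hx2, hhx⟩ := hentry₂ z ⟨hzT, hzr⟩
    exact ⟨x, hx1, hx2, hhx⟩
  · -- NO RIM CONTACT on `[rs, 2.9ρ']`
    intro z hz hzT hzlo hzhi x hx1 hx2 heq
    obtain ⟨-, -, hTd', -⟩ := hT (z 0) hzT
    have hzlo' : 3 * d.excision i (z 0) + 2 * R₀ ≤ r z := by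
      have : ρ' (z 0) ≤ r z := hzlo
      linarith [le_max_left (d.excision i (z 0)) 0, le_max_right (d.excision i (z 0)) 0]
    exact hrim z hz hzT hzlo' hzhi x hx1 hx2 heq
  · -- LOCATION on the collar `[1.1ρ', 2.9ρ']`, read at the hole clock
    intro z hz hzT hzlo hzhi x hx1 hx2 heq
    obtain ⟨hTb', -, hTd', -, -, hT4, -⟩ := hT (z 0) hzT
    have hzlo' : 3 * d.excision i (z 0) + 2 * R₀ ≤ r z := by
      linarith [le_max_left (d.excision i (z 0)) 0, le_max_right (d.excision i (z 0)) 0, hρpos (z 0)]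
    obtain ⟨-, hlt, hlr⟩ := hlocate z hz hzT hzlo' hzhi x hx1.le (hadm' x hx1.le hx2.le) heq
    have hP0 : 0 < ρ' (z 0) := hρpos _
    -- the hole clock of `z` reads an earlier time than `z⁰`: `⅔(γ tᵢ z + c⁰) ≤ z⁰`
    obtain ⟨hcz1, -⟩ := abs_le.1 (hclock z)
    have hβrz : β * (r z + A) ≤ β * (29 / 10 * ρ' (z 0) + A) :=
      mul_le_mul_of_nonneg_left (by linarith) hβ0
    have hγP : 0 ≤ γ / 100 * ρ' (z 0) := by positivity
    have hearly : 2 / 3 * (γ * t z + c₀) ≤ z 0 := by nlinarith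
    have hκle : κ₁ (z 0) ≤ κ (t z) := by
      rw [hκ]
      exact hanti hearly
    have hκmul := mul_le_mul_of_nonneg_right hκle hP0.le
    exact ⟨hlt.trans hκmul, hlr.trans hκmul⟩

end Summit.FinalStateConjecture.FinalStateConjecture.Theorems.GapDecaySuffices.V10

end
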